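import Summits.BirchSwinnertonDyer.BirchSwinnertonDyer.Theorems.AdditiveKolyvaginRoadKolyvaginTransverseIsotropy
import Summits.BirchSwinnertonDyer.BirchSwinnertonDyer.Theorems.AdditiveKolyvaginRoadLocalDictionaries
import Summits.BirchSwinnertonDyer.BirchSwinnertonDyer.Theorems.KolyvaginRoadThreeZhangSupplyTransverseLagrangian
import HarnessLib

/-!
# Route `AdditiveKolyvaginRoad`, crux `KolyvaginPrimitiveAdditive` (item stmt-BirchSwinnertonDyer-20132):
# stub LOC, towards (Supply) at a general odd prime `p` — (Lag-tr): the Kolyvagin character `χ : Γ_{K_λ} → Gal(K[ℓ]/K)`,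
# the dictionary `loc⁻¹(transverseLocalCondition) ⊆ transverseLocalKerP`, and the isotropy of the genuine transverse
# condition (p-generic port of koly3b's `…ZhangSupplyTransverseLagrangian`, part XIX, `3 ↦ p¹`)
# (cell `pub/bsd-wall`, lead prover `bsd-wall-akr-p1` g3; `--supports stmt-BirchSwinnertonDyer-20132`, helper)

WHY THIS FILE. The GLOBAL half of (Supply) for stub LOC (see this seat's PORT MAP in HOME/bsd-wall-akr-p1/NOTES_g3.md)
needs, at the Kolyvagin primes `λ' ∈ T` of the level structure, that the genuine transverse local condition is
LAGRANGIAN: the dictionary clause `htrIncl`, the isotropy clause `htrIso` (this file) and the cardinality clause `htrCard`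
(koly3b part XX, next). Everything here is koly3b's text with `3 ↦ p¹` over bsd-jet's decomposition-trivial lemmas, this
seat's `smul_ringClassFieldOne_eq_self_of_mem_decompositionSubgroup_P` and `transverseLocalKerP`; the one arithmetic step
(`3 · μ₃ = 0` in the Mazur–Rubin cyclic mechanism) becomes `(2k+1) · μ_p = 0`, `p = 2k + 1`.

WHAT. `exists_kolyvagin_character_P`, `htrIncl_transverseLocalCondition_P`, `htrIso_transverseLocalCondition_P` (`p` odd).

HONEST FRAMING: theorems only; 0 definitions, 0 named facts, 0 `sorry`; closes nothing.

References: [cite: WZhang2014, §8.1, Lemma 8.4] [cite: GrossLMS1991, §3–§4] [cite: MazurRubin2004, Prop. 1.3.2 (ii)]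
[cite: NeukirchANT1999, Ch. I §9 Prop. (9.1), Ch. II §9 Prop. (9.6)] [cite: Cox2013, §7.D Thm. 7.24, §9.A].
-/

-- single-conjunct summit: `Summit.BirchSwinnertonDyer.BirchSwinnertonDyer.…` repeats the name by design
set_option linter.dupNamespace false

noncomputable section

open scoped Classical Pointwise

universe u

namespace Summit.BirchSwinnertonDyer.BirchSwinnertonDyer.Theorems.AdditiveKoly

open CategoryTheory WeierstrassCurve Field Function NumberField IsDedekindDomain
open Literature.NumberTheory.EllipticCurves Literature.NumberTheory.EllipticCurves.ModularForms
  Literature.NumberTheory.GaloisRepresentations Module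
open Literature.NumberTheory.GaloisRepresentations.DiscreteGaloisModule (mu MuCarrier)
open Literature.NumberTheory.GaloisCohomology
open Summit.BirchSwinnertonDyer.Rank1Residual.X11b.Three.Koly.Method2
open Summit.BirchSwinnertonDyer.Rank1Residual.X11b.Three.Koly.Method2.KolyLocal
open Summit.BirchSwinnertonDyer.Rank1Residual.X11b.Three.Koly.ZhangSupply
open Summit.BirchSwinnertonDyer.Rank1Residual.GaloisImage
open Summit.BirchSwinnertonDyer.Rank1Residual.JET Summit.BirchSwinnertonDyer.Rank1Residual.X11b
open scoped ContRepresentation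

variable (W : WeierstrassCurve ℚ) (K : Type) [Field K] [NumberField K] (p : ℕ) [W.IsElliptic] [W.IsGloballyMinimal]
  [Fact p.Prime] [∀ v : Place K, CompactSpace (absoluteGaloisGroup (Place.Completion v))]
  [Finite (geomTorsion (W.baseChange K) ((p ^ 1 : ℕ) : ℤ))]

/-! ## §1 The local package at a Kolyvagin prime: the character `χ : Γ_{K_λ} → Gal(K[ℓ]/K)` -/


omit [∀ v : Place K, CompactSpace (absoluteGaloisGroup (Place.Completion v))]
  [Finite (geomTorsion (W.baseChange K) ((p ^ 1 : ℕ) : ℤ))] in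
/-- **The local package at a Kolyvagin prime `λ ∋ ℓ`** (`K` imaginary quadratic with `d_K < −4`, `ℓ` a Kolyvagin prime
of W. Zhang at general `p`): the restriction character `χ : Γ_{K_λ} → Gal(K[ℓ]/K)` along a `K`-embedding of `K[ℓ]`
(`KolyvaginH44.exists_absGaloisRestrict`) with: `Γ_{K_λ}` fixes `E[p]` (`decompositionSubgroup_le_torsionFixing`);
`ker χ = res⁻¹(Stab K[ℓ])`; `χ` locally constant; an element `σ₁` with `χ(Γ_{K_λ}) = ⟨χ σ₁⟩` of order `ℓ + 1` (the image
lies in the cyclic `G_ℓ = Gal(K[ℓ]/K[1])` as `λ` splits in `K[1]`, and is ALL of it as the primes above `λ` are totally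
ramified in `K[ℓ]/K[1]`: tree `RingClassTower.exists_mem_inertia_smul_eq_of_mem_ringClassGalOver`,
`card_ringClassGalOver_div_eq_succ`); and the decomposition-group bookkeeping at the prime `𝔓` cut out by the chosen
embedding (`res Γ_{K_λ} = G_𝔓`). [cite: GrossLMS1991, §3 (G_ℓ cyclic of order ℓ+1; λ totally ramified)]
[cite: WZhang2014, §8.1] [cite: NeukirchANT1999, Ch. II §9 Prop. (9.6)] -/
theorem exists_kolyvagin_character_P (hK : IsImaginaryQuadratic K) (hd : NumberField.discr K < -4) (ι : K →+* ℂ)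
    {ℓ : ℕ} (hℓ : Zhang2014.IsKolyvaginPrime (W.conductorNorm ℤ) W K p ℓ) (v : HeightOneSpectrum (𝓞 K))
    (hv : (ℓ : 𝓞 K) ∈ v.asIdeal) :
    ∃ (𝔐 : Ideal (HeightOneSpectrum.localAbsIntegers v)) (_ : 𝔐 ∈ v.localPrimesAbove)
      (χ : absoluteGaloisGroup (v.adicCompletion K) →* ringClassGal ι ℓ) (σ₁ : absoluteGaloisGroup (v.adicCompletion K)),
      (∀ (s : absoluteGaloisGroup (v.adicCompletion K)) (Q : geomTorsion (W.baseChange K) ((p ^ 1 : ℕ) : ℤ)),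
        absGaloisRestrict K (v.adicCompletion K) s • Q = Q) ∧
      (∀ s : absoluteGaloisGroup (v.adicCompletion K),
        absGaloisRestrict K (v.adicCompletion K) s ∈ torsionFixing (W.baseChange K) ((p ^ 1 : ℕ) : ℤ)) ∧
      (∀ s : absoluteGaloisGroup (v.adicCompletion K),
        χ s = 1 ↔ absGaloisRestrict K (v.adicCompletion K) s ∈ ringClassStabilizer K ι ℓ ℓ) ∧
      IsLocallyConstant χ ∧
      (∀ s : absoluteGaloisGroup (v.adicCompletion K), ∃ i : ℕ, χ s = χ σ₁ ^ i) ∧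
      orderOf (χ σ₁) = ℓ + 1 := by
  have hk1 : 1 ≤ Zhang2014.kolyvaginIndex W p ℓ := hℓ.2.2.2.2.2
  have hℓp : ℓ.Prime := hℓ.1
  have hℓ0 : ℓ ≠ 0 := hℓp.ne_zero
  have hℓP : (Ideal.span {(ℓ : 𝓞 K)}).IsPrime := hℓ.2.2.2.2.1
  haveI := (finiteDimensional_and_isGalois_ringClassField hK ι hℓ0).1
  haveI := (finiteDimensional_and_isGalois_ringClassField hK ι hℓ0).2
  haveI := (finiteDimensional_and_isGalois_ringClassField hK ι one_ne_zero).1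
  haveI : FiniteDimensional ℚ (ringClassField K ι ℓ) := Module.Finite.trans K (ringClassField K ι ℓ)
  set Kv := v.adicCompletion K with hKv
  set ι₀ := closureEmb (K := K) Kv with hι₀
  obtain ⟨𝔐, h𝔐⟩ := v.localPrimesAbove_nonempty
  set 𝔓 := v.primeBelow ι₀ 𝔐 with h𝔓def
  have h𝔓 : 𝔓 ∈ v.primesAbove := HeightOneSpectrum.primeBelow_mem_primesAbove h𝔐
  have hres : ∀ s : absoluteGaloisGroup Kv,
      absGaloisRestrict K Kv s ∈ 𝔓.decompositionSubgroup (absoluteGaloisGroup K) := fun s ↦ by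
    rw [← resGal_eq_absGaloisRestrict, resGal_eq]
    exact resGalOfEmb_mem_decompositionSubgroup ι₀ h𝔐 s
  have hfix : ∀ (s : absoluteGaloisGroup Kv) (Q : geomTorsion (W.baseChange K) ((p ^ 1 : ℕ) : ℤ)),
      absGaloisRestrict K Kv s • Q = Q := fun s Q ↦
    GlobalDuality.smul_torsion_eq_self_of_mem_decompositionSubgroup W K hK hℓ hk1 v hv h𝔓 (hres s) Q
  have htf : ∀ s : absoluteGaloisGroup Kv,
      absGaloisRestrict K Kv s ∈ torsionFixing (W.baseChange K) ((p ^ 1 : ℕ) : ℤ) := fun s ↦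
    GlobalDuality.decompositionSubgroup_le_torsionFixing W K hK hℓ hk1 v hv h𝔓 (hres s)
  -- the restriction `χ : Γ_{K_v} → Gal(K[ℓ]/K)` along a `K`-embedding `e₀ : K[ℓ] → K̄`
  let e₀ : ringClassField K ι ℓ →ₐ[K] AlgebraicClosure K := IsAlgClosed.lift
  obtain ⟨π, hπ⟩ := KolyvaginH44.exists_absGaloisRestrict hK ι ℓ e₀
  let χ : absoluteGaloisGroup Kv →* ringClassGal ι ℓ := π.comp (absGaloisRestrict K Kv).toMonoidHom
  have hχ : ∀ s, χ s = π (absGaloisRestrict K Kv s) := fun _ ↦ rfl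
  -- `π d = 1 ⟺ d` fixes `e₀(K[ℓ])`
  have hπ1 : ∀ d : absoluteGaloisGroup K, π d = 1 ↔ ∀ z, d • e₀ z = e₀ z := by
    intro d
    constructor
    · intro h z
      rw [hπ, h, OneMemClass.coe_one, AlgEquiv.one_apply]
    · intro h
      apply Subtype.ext
      refine AlgEquiv.ext fun z ↦ e₀.injective ?_
      change e₀ _ = e₀ _
      rw [← hπ, h z, OneMemClass.coe_one, AlgEquiv.one_apply]
  have hker : ∀ s, χ s = 1 ↔ absGaloisRestrict K Kv s ∈ ringClassStabilizer K ι ℓ ℓ := by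
    intro s
    rw [hχ, hπ1]
    constructor
    · intro h
      exact mem_ringClassStabilizer_of_forall_smul_eq K hK ι hℓ0 e₀ h
    · intro h z
      exact (mem_ringClassStabilizer_iff.mp h) e₀ z z.2
  -- `χ` is locally constant: `ker χ ⊇ res⁻¹ Gal(K̄/e₀(K[ℓ]))`, an open subgroup
  have hlc : IsLocallyConstant χ := by
    haveI : FiniteDimensional K e₀.fieldRange := Module.Finite.equiv (AlgEquiv.ofInjectiveField e₀).toLinearEquiv
    have hopenF := IntermediateField.fixingSubgroup_isOpen e₀.fieldRange
    have hle : ((e₀.fieldRange).fixingSubgroup).comap (absGaloisRestrict K Kv).toMonoidHom ≤ χ.ker := by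
      intro s hs
      rw [MonoidHom.mem_ker, hχ, hπ1]
      intro z
      have h := (IntermediateField.mem_fixingSubgroup_iff _ _).mp hs (e₀ z) ⟨z, rfl⟩
      exact h
    have hopen : IsOpen (χ.ker : Set (absoluteGaloisGroup Kv)) :=
      Subgroup.isOpen_mono hle (hopenF.preimage (absGaloisRestrict K Kv).continuous)
    refine (IsLocallyConstant.iff_exists_open χ).mpr fun s ↦ ⟨(fun t ↦ s * t) '' (χ.ker : Set _), ?_, ?_, ?_⟩
    · exact (Homeomorph.mulLeft s).isOpenMap _ hopen
    · exact ⟨1, χ.ker.one_mem, mul_one s⟩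
    · rintro _ ⟨t, ht, rfl⟩
      rw [map_mul, (MonoidHom.mem_ker).mp ht, mul_one]
  -- the image of `χ` lies in the cyclic `G_ℓ = Gal(K[ℓ]/K[1])`
  have h1ℓ : ringClassField K ι 1 ≤ ringClassField K ι ℓ := ringClassField_mono hK ι (one_dvd ℓ) hℓ0
  have himg : ∀ s, ((χ s : ringClassGal ι ℓ) : ringClassField K ι ℓ ≃ₐ[ℚ] ringClassField K ι ℓ) ∈
      ringClassGalOver ι ℓ (ℓ / ℓ) := by
    intro s
    rw [Nat.div_self hℓp.pos, ringClassGalOver, mem_fixingSubgroup_iff]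
    intro z hz
    rw [AlgEquiv.smul_def]
    obtain ⟨z₁, hz₁⟩ : ∃ z₁ : ringClassField K ι 1, RingClassField.inclusion ι h1ℓ z₁ = z :=
      ⟨⟨(z : ℂ), hz⟩, Subtype.ext (RingClassField.coe_inclusion ι h1ℓ _)⟩
    have key : e₀ (((χ s : ringClassGal ι ℓ) : ringClassField K ι ℓ ≃ₐ[ℚ] ringClassField K ι ℓ) z) = e₀ z := by
      rw [hχ, ← hπ, ← hz₁]
      exact smul_ringClassFieldOne_eq_self_of_mem_decompositionSubgroup_P W K p hK ι hℓ v hv h𝔓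
        (e₀.comp (RingClassField.inclusion ι h1ℓ)) (hres s) z₁
    exact e₀.injective key
  -- a generator `g₀` of `G_ℓ`, of order `ℓ + 1`, realised by an inertia element `τ = res σ₁`
  have hℓℓ : ¬ ℓ ∣ ℓ / ℓ := by
    rw [Nat.div_self hℓp.pos]; exact fun h ↦ hℓp.one_lt.ne' (Nat.dvd_one.mp h)
  obtain ⟨g₀, hg₀⟩ := RingClassTower.exists_zpowers_eq_ringClassGalOver hK ι hℓ0 hℓp (dvd_refl ℓ) hℓℓ hℓP
  have hord : orderOf g₀ = ℓ + 1 :=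
    RingClassTower.orderOf_eq_succ_of_zpowers_eq_ringClassGalOver hK ι hℓp hℓP (dvd_refl ℓ) hℓℓ hℓ0 (Or.inr hd) hg₀
  have hv₀ : ∀ v' : HeightOneSpectrum (𝓞 K), ((ℓ : ℕ) : 𝓞 K) ∈ v'.asIdeal ↔ v' = v :=
    fun v' ↦ ⟨fun h ↦ placesAbove_eq_of_isPrime_span K hℓP hℓ0 hv h, fun h ↦ h ▸ hv⟩
  obtain ⟨τ, hτI, hτ⟩ := RingClassTower.exists_mem_inertia_smul_eq_of_mem_ringClassGalOver hK ι hℓ0 hℓp (dvd_refl ℓ)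
    hℓℓ hv₀ h𝔓 e₀ (hg₀ ▸ Subgroup.mem_zpowers g₀)
  have hτD : τ ∈ 𝔓.decompositionSubgroup (absoluteGaloisGroup K) := Ideal.inertia_le_stabilizer _ hτI
  obtain ⟨σ₁, hσ₁⟩ := KolyLocal.exists_absGaloisRestrict_eq_of_mem_decompositionSubgroup (K := K) (v := v) h𝔐 hτD
  have hχσ₁ : ((χ σ₁ : ringClassGal ι ℓ) : ringClassField K ι ℓ ≃ₐ[ℚ] ringClassField K ι ℓ) = g₀ := by
    refine AlgEquiv.ext fun z ↦ e₀.injective ?_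
    change e₀ _ = e₀ _
    rw [hχ, ← hπ, hσ₁, hτ z]
  have hordσ₁ : orderOf (χ σ₁) = ℓ + 1 := by
    rw [← orderOf_submonoid (χ σ₁), hχσ₁, hord]
  have hgen : ∀ s, ∃ i : ℕ, χ s = χ σ₁ ^ i := by
    intro s
    have hs : ((χ s : ringClassGal ι ℓ) : ringClassField K ι ℓ ≃ₐ[ℚ] ringClassField K ι ℓ) ∈ Subgroup.zpowers g₀ := by
      rw [hg₀]; exact himg s
    rw [← mem_powers_iff_mem_zpowers, Submonoid.mem_powers_iff] at hs
    obtain ⟨i, hi⟩ := hs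
    refine ⟨i, Subtype.ext ?_⟩
    rw [SubmonoidClass.coe_pow, hχσ₁, hi]
  exact ⟨𝔐, h𝔐, χ, σ₁, hfix, htf, hker, hlc, hgen, hordσ₁⟩

/-! ## §2 The dictionary clause `htrIncl`: `loc_λ x ∈ transverseLocalCondition ⟹ x ∈ transverseLocalKer` -/

omit [∀ v : Place K, CompactSpace (absoluteGaloisGroup (Place.Completion v))]
  [Finite (geomTorsion (W.baseChange K) ((p ^ 1 : ℕ) : ℤ))] in
/-- **(Lag-tr), dictionary clause `htrIncl`** of `hjump_of_localLagrangians` for `Ltr λ := transverseLocalCondition`: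
at a Kolyvagin prime `λ ∋ ℓ`, if the localisation of `x ∈ H¹(K, E[p])` is represented by a cocycle vanishing on
`res⁻¹(Stab K[ℓ])`, then `x ∈ Method2.transverseLocalKer W K ι ℓ λ`: on `Γ_{K_λ}` (which fixes `E[p]`) cohomologous
cocycles agree, `G_𝔓 = res Γ_{K_λ}` for the prime `𝔓` cut out by the chosen embedding, and the other primes above `λ`
are conjugate (`exists_smul_eq_of_mem_primesAbove_holds`; `h1Eval_conj`, normality of the stabiliser and of
`Γ_{K(E[p])}`). [cite: WZhang2014, §8.1 (H¹_tr)] [cite: NeukirchANT1999, Ch. I §9 Prop. (9.1), Ch. II §9 Prop. (9.6)] -/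
theorem htrIncl_transverseLocalCondition_P (hK : IsImaginaryQuadratic K) (ι : K →+* ℂ) {ℓ : ℕ}
    (hℓ : Zhang2014.IsKolyvaginPrime (W.conductorNorm ℤ) W K p ℓ) (v : HeightOneSpectrum (𝓞 K))
    (hv : (ℓ : 𝓞 K) ∈ v.asIdeal) (x : Vp W K p)
    (hx : galoisCohomology.localization ((W.baseChange K).torsionGaloisModule ((p ^ 1 : ℕ) : ℤ)) (Sum.inr v) 1 x ∈
      transverseLocalCondition (W.baseChange K) ι ℓ (v.adicCompletion K) ((p ^ 1 : ℕ) : ℤ)) :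
    x ∈ transverseLocalKerP W K p ι ℓ v := by
  have hk1 : 1 ≤ Zhang2014.kolyvaginIndex W p ℓ := hℓ.2.2.2.2.2
  set Kv := v.adicCompletion K with hKv
  set ι₀ := closureEmb (K := K) Kv with hι₀
  obtain ⟨𝔐, h𝔐⟩ := v.localPrimesAbove_nonempty
  set 𝔓 := v.primeBelow ι₀ 𝔐 with h𝔓def
  have h𝔓 : 𝔓 ∈ v.primesAbove := HeightOneSpectrum.primeBelow_mem_primesAbove h𝔐
  have hres : ∀ s : absoluteGaloisGroup Kv,
      absGaloisRestrict K Kv s ∈ 𝔓.decompositionSubgroup (absoluteGaloisGroup K) := fun s ↦ by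
    rw [← resGal_eq_absGaloisRestrict, resGal_eq]
    exact resGalOfEmb_mem_decompositionSubgroup ι₀ h𝔐 s
  have hfix : ∀ (s : absoluteGaloisGroup Kv) (Q : geomTorsion (W.baseChange K) ((p ^ 1 : ℕ) : ℤ)),
      absGaloisRestrict K Kv s • Q = Q := fun s Q ↦
    GlobalDuality.smul_torsion_eq_self_of_mem_decompositionSubgroup W K hK hℓ hk1 v hv h𝔓 (hres s) Q
  -- the representatives: `x = [φ]`, `loc x = [ψ]` with `ψ` vanishing on `res⁻¹(Stab K[ℓ])`
  obtain ⟨ψ, hψ0, hψ⟩ := hx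
  set φ := reprCocycle (W.baseChange K) ((p ^ 1 : ℕ) : ℤ) x with hφ
  have hxφ : oneCocycleClass _ φ = x := oneCocycleClass_reprCocycle (W.baseChange K) ((p ^ 1 : ℕ) : ℤ) x
  -- `φ (res s) = ψ s` on `Γ_{K_v}` (cohomologous cocycles agree: `Γ_{K_v}` fixes `E[p]`)
  have hagree : ∀ s : absoluteGaloisGroup Kv, φ.1 (absGaloisRestrict K Kv s) = ψ.1 s := by
    have h : galoisCohomology.localization ((W.baseChange K).torsionGaloisModule ((p ^ 1 : ℕ) : ℤ)) (Sum.inr v) 1 x =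
        oneCocycleClass _ (contOneCocycles.pullback (absGaloisRestrict K Kv)
          (X := discreteTopRep (absoluteGaloisGroup K) (geomTorsion (W.baseChange K) ((p ^ 1 : ℕ) : ℤ)))
          (Y := DiscreteGaloisModule.toTopRep (GaloisRep.restrictField Kv
            ((W.baseChange K).torsionGaloisModule ((p ^ 1 : ℕ) : ℤ))))
          (TopRep.ofHom ⟨ContinuousLinearMap.id ℤ _, fun _ ↦ rfl⟩) φ) := by
      rw [← hxφ]
      exact res_torsionGaloisModule_oneCocycleClass (W.baseChange K) ((p ^ 1 : ℕ) : ℤ) Kv φ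
    rw [h, ← sub_eq_zero, ← oneCocycleClass_sub, oneCocycleClass_eq_zero_iff] at hψ
    obtain ⟨m, hm⟩ := hψ
    intro s
    have hs : ψ.1 s - φ.1 (absGaloisRestrict K Kv s) = absGaloisRestrict K Kv s • m - m := hm s
    rw [hfix, sub_self, sub_eq_zero] at hs
    exact hs.symm
  -- the criterion at the prime `𝔓`, then at every prime above `v` by conjugation
  have h𝔓case : ∀ d : absoluteGaloisGroup K, d ∈ 𝔓.decompositionSubgroup (absoluteGaloisGroup K) →
      d ∈ ringClassStabilizer K ι ℓ ℓ → φ.1 d = 0 := by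
    intro d hdD hdS
    obtain ⟨s, rfl⟩ := KolyLocal.exists_absGaloisRestrict_eq_of_mem_decompositionSubgroup (K := K) (v := v) h𝔐 hdD
    rw [hagree]
    exact hψ0 s hdS
  rw [mem_transverseLocalKerP_iff]
  intro 𝔓' h𝔓' d hdD hdS hdT
  obtain ⟨τ, hτ⟩ := HeightOneSpectrum.exists_smul_eq_of_mem_primesAbove_holds (K := K) (v := v) h𝔓 h𝔓'
  -- `d = τ d₀ τ⁻¹` with `d₀ ∈ G_𝔓 ∩ Stab K[ℓ] ∩ Γ_{K(E[p])}`
  set d₀ := τ⁻¹ * d * τ⁻¹⁻¹ with hd₀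
  have hd₀D : d₀ ∈ 𝔓.decompositionSubgroup (absoluteGaloisGroup K) := by
    rw [← hτ, Ideal.decompositionSubgroup_smul] at hdD
    rw [hd₀, inv_inv]
    have h := Subgroup.mem_pointwise_smul_iff_inv_smul_mem.mp hdD
    first
      | rw [MulAut.conj_inv_apply] at h
      | rw [MulAut.smul_def, MulAut.conj_inv_apply] at h
    exact h
  have hd₀S : d₀ ∈ ringClassStabilizer K ι ℓ ℓ := (ringClassStabilizer_normal K ι ℓ ℓ).conj_mem d hdS τ⁻¹
  have hd₀T : d₀ ∈ torsionFixing (W.baseChange K) ((p ^ 1 : ℕ) : ℤ) :=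
    (torsionFixing_normal (W.baseChange K) ((p ^ 1 : ℕ) : ℤ)).conj_mem d hdT τ⁻¹
  have hd : d = τ * d₀ * τ⁻¹ := by rw [hd₀, inv_inv]; group
  rw [hd, h1Eval_conj (W.baseChange K) ((p ^ 1 : ℕ) : ℤ) x τ hd₀T, ← hxφ,
    h1Eval_oneCocycleClass (W.baseChange K) ((p ^ 1 : ℕ) : ℤ) φ hd₀T, h𝔓case d₀ hd₀D hd₀S, smul_zero]

/-! ## §3 The isotropy clause `htrIso` -/

omit [Finite (geomTorsion (W.baseChange K) ((p ^ 1 : ℕ) : ℤ))] in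
/-- **(Lag-tr), isotropy clause `htrIso`** of `hjump_of_localLagrangians` for `Ltr λ := transverseLocalCondition`: at a
Kolyvagin prime (with `d_K < −4`) the genuine transverse condition is isotropic for the local Weil cup product of every
`Γ_K`-equivariant `μ_p`-valued pairing on `E[p]` — the Mazur–Rubin mechanism on the cyclic quotient `Gal(K[ℓ]/K[1])` at
the odd exponent `p` (tree `TransverseCup.cupClass_eq_zero_of_fixed_of_cyclic`), as in zhang3-p1's global-currency
`KolyLocal.cupProduct_eq_zero_of_mem_transverseLocalKer`, here for LOCAL classes. [cite: WZhang2014, §8.1, Lemma 8.4]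
[cite: MazurRubin2004, Prop. 1.3.2 (ii)] [cite: GrossLMS1991, §3–§4] -/
theorem htrIso_transverseLocalCondition_P (hK : IsImaginaryQuadratic K) (hp2 : p ≠ 2) (hd : NumberField.discr K < -4)
    (ι : K →+* ℂ)
    {ℓ : ℕ} (hℓ : Zhang2014.IsKolyvaginPrime (W.conductorNorm ℤ) W K p ℓ) (v : HeightOneSpectrum (𝓞 K))
    (hv : (ℓ : 𝓞 K) ∈ v.asIdeal)
    (e : geomTorsion (W.baseChange K) ((p ^ 1 : ℕ) : ℤ) → geomTorsion (W.baseChange K) ((p ^ 1 : ℕ) : ℤ) →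
      AlgebraicClosure K)
    (hμ : ∀ P Q, e P Q ^ (p ^ 1) = 1) (hadd₁ : ∀ P₁ P₂ Q, e (P₁ + P₂) Q = e P₁ Q * e P₂ Q)
    (hadd₂ : ∀ P Q₁ Q₂, e P (Q₁ + Q₂) = e P Q₁ * e P Q₂)
    (hgal : ∀ (σ : absoluteGaloisGroup K) (P Q : geomTorsion (W.baseChange K) ((p ^ 1 : ℕ) : ℤ)),
      σ • e P Q = e (σ • P) (σ • Q)) :
    ∀ a ∈ transverseLocalCondition (W.baseChange K) ι ℓ (v.adicCompletion K) ((p ^ 1 : ℕ) : ℤ),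
    ∀ b ∈ transverseLocalCondition (W.baseChange K) ι ℓ (v.adicCompletion K) ((p ^ 1 : ℕ) : ℤ),
      (weilContPairingLocal (W.baseChange K) (p ^ 1) e hμ hadd₁ hadd₂ hgal (Sum.inr v)).cupProduct a b = 0 := by
  intro a ha b hb
  haveI : CompactSpace (absoluteGaloisGroup (v.adicCompletion K)) :=
    ‹∀ v : Place K, CompactSpace (absoluteGaloisGroup (Place.Completion v))› (Sum.inr v)
  have hp : p.Prime := Fact.out
  obtain ⟨k, hk⟩ : ∃ k, p = 2 * k + 1 := hp.odd_of_ne_two hp2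
  obtain ⟨𝔐, h𝔐, χ, σ₁, hfix, -, hker, -, hgen, -⟩ := exists_kolyvagin_character_P W K p hK hd ι hℓ v hv
  obtain ⟨ψa, hψa0, rfl⟩ := ha
  obtain ⟨ψb, hψb0, rfl⟩ := hb
  erw [ContPairing.cupProduct_oneCocycleClass]
  refine TransverseCup.cupClass_eq_zero_of_fixed_of_cyclic _ χ _ _ (fun s t ↦ ?_) (fun s t ↦ ?_)
    (fun s hs ↦ hψa0 s ((hker s).mp hs)) (fun s hs ↦ hψb0 s ((hker s).mp hs)) ⟨σ₁, hgen⟩ k (fun z ↦ ?_)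
  · exact hfix t _
  · exact hfix t _
  · -- `p • μ_p = 0`
    have h3 : (2 * k + 1) • z = ((p ^ 1 : ℕ) : ℤ) • z := by
      rw [← natCast_zsmul, ← hk]
      exact congrArg (fun j : ℕ ↦ (j : ℤ) • z) (pow_one p).symm
    rw [h3]
    exact zsmul_muCarrier_eq_zero K (p ^ 1) z


end Summit.BirchSwinnertonDyer.BirchSwinnertonDyer.Theorems.AdditiveKoly

end
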